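import Literature.Probability.Percolation.IsoradialCrossingPaths
import Literature.Probability.Percolation.IsoradialArmComparabilityProofs
import Literature.Probability.Percolation.HalfSpacePinnedPairs
import HarnessLib

/-!
# Extending one arm across a doubled annulus: Grimmett–Manolescu's Prop. 8.2 (a), (b) for `k = 1`,
# under the box-crossing property

Topic `Literature/Probability/Percolation`; proofs-only support file (no definition, no named
fact) for the arm-comparability fact `GrimmettManolescu2014_armComparability_one_two` (`T`,
file `IsoradialArmComparability`). Grimmett–Manolescu, *Bond percolation on isoradial graphs*,
PTRF 159 (2014) = arXiv:1204.0505, §8.2, Prop. (exp_equiv): "There exist constants `cᵢ > 0`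
such that, for `n > N` sufficiently large, (a) `P_G[A_k(N, 2n)] ≤ P_G[A_k(N, n)] ≤
c₁ P_G[A_k(N, 2n)]`, (b) `P_G[A_k(N, n)] ≤ P_G[A_k(2N, n)] ≤ c₂ P_G[A_k(N, n)]`" (constants
depending on `k`, `ε`, `I`), of which the source says (§8.5.2): "Inequalities (a) and (b) follow
from Theorem (separation) and the box-crossing property. The proof, omitted here, is
essentially that of [Nolin], and uses the extension of paths by judiciously positioned
box-crossings." For **one arm** (`k = 1`) no separation of arms is needed, and this
file carries the exercise out in the tree's rendering (`RhombicEmbedding.embArmEvent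
oneArmColour r R`: an open path from `Λ_r` to `{R ≤ ‖·‖_∞}` inside `Λ_{R+2} ∖ Λ_{r-2}`), for an
**arbitrary isoradial rhombic tiling whose canonical measure satisfies the box-crossing bounds
at aspect ratio `4`** (`BoxCrossingBounds P_G z 4 c n₀`, the hypothesis being exactly what the
unproved named fact `gm_boxCrossingBounds_uniform` — Theorem 3.1 of the source in its uniform
form (3.1), `δ = δ(ε, I)` — supplies uniformly on the class `𝒢(ε, I)`; the corresponding
statements for the class, conditional on that fact, are in §6):

* `embArmProb_inward` — **(b), second inequality**: `c⁵ · P_G[A₁(2N, n)] ≤ P_G[A₁(N, n)]` for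
  `N ≥ n₀ ⊔ 2`, `n ≥ 4N`;
* `embArmProb_outward` — **(a), second inequality** in scale form:
  `c⁵ · P_G[A₁(N, 2m)] ≤ P_G[A₁(N, 4m)]` for `m ≥ n₀ ⊔ 2 ⊔ N`;
* the first inequalities of (a), (b) (constant `1`) are the elementary inclusions proved in
  `IsoradialArmComparabilityProofs` (`embArmProb_outer_anti`, `embArmProb_inner_mono`);
* printed shapes and iterations: `embArmProb_double_inner_le` (`c⁻⁵`),
  `embArmProb_le_double_outer` (`c⁻¹⁰`), `embArmProb_pow_two_inner_le`,
  `embArmProb_le_pow_two_outer`;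
* on the class `𝒢(ε, I)`, conditional on `gm_boxCrossingBounds_uniform` (GM Thm 3.1 / (3.1)):
  `oneArm_double_inner_of_gm_boxCrossingBounds_uniform`,
  `oneArm_double_outer_of_gm_boxCrossingBounds_uniform` — Prop. (exp_equiv) (a), (b) for
  `k = 1` with constants depending on `(ε, I)` only, as printed.

The argument is the textbook one (Kesten 1982, §2; Grimmett 1999, §11.7; Nolin 2008, §3,
"extendability"): on the event that the four `8N × 2N` strips of the square annulus
`Λ_{4N} ∖ Λ_{2N}` are crossed the long way, that the `4N × N` rectangle `[0, 4N] × [-N/2, N/2]`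
is crossed horizontally, and that `A₁(2N, n)` occurs, the arm, the radial crossing and the four
strip crossings all belong to one open cluster — by the deterministic gluing theorems of
`IsoradialCrossingPaths` (Maehara's crossing lemma plus the planarity of rhombic tilings) — and
following that cluster from the start of the radial crossing (inside `Λ_N`) to the end of the
arm gives `A₁(N, n)` (`mem_embArmEvent_of_inward`); the six events are increasing, so Harris'
inequality (`prodBernoulli_harris`) and the box-crossing lower bound `c` give the factor `c⁵`.
The outward extension is the same picture at scale `m = n/2` with the radial rectangle
`[0, 4m] × [-m/2, m/2]` (`mem_embArmEvent_of_outward`).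

Also recorded: the walk form of the one-arm event (`embArmEvent_oneArm_eq_openCrossing`,
`mem_embArmEvent_oneArm_of_walk`: any open walk from `Λ_r` to `{R ≤ ‖·‖_∞}` staying inside
`Λ_{R+2}` yields `A₁(r, R)` after restarting it at its last visit to `Λ_r`), whence the one-arm
event is increasing and measurable.

## References

* G. R. Grimmett, I. Manolescu, PTRF 159 (2014) 273–327 = arXiv:1204.0505: §8.2
  Prop. (exp_equiv) (a), (b); §8.5.2 ("(a) and (b) follow from Theorem (separation) and the
  box-crossing property. The proof, omitted here, is essentially that of [Nolin], and uses the
  extension of paths by judiciously positioned box-crossings"; the circuits `H_M`, `K_m`).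
* H. Kesten, *Percolation Theory for Mathematicians* (1982), §2.2–2.4; G. Grimmett,
  *Percolation*, 2nd ed. (1999), Thm. (2.4) (Harris–FKG), §11.7 (RSW gluing); P. Nolin,
  *Near-critical percolation in two dimensions*, EJP 13 (2008), §3 (extendability of arms).
-/

noncomputable section

open Set Complex MeasureTheory
open Literature.Topology.PlaneTopology

namespace Literature.Probability.Percolation

namespace IsoradialArmExtension

open Literature.Probability.LatticeModels IsoradialCrossingPaths IsoradialArmComparability

variable {V F : Type*} {G : SimpleGraph V} (emb : RhombicEmbedding G F)

/-! ### §1 The one-arm event in walk form -/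

/-- **Building the one-arm event from a walk.** An open walk from `Λ_r` to `{R ≤ ‖·‖_∞}` with
all vertices in `Λ_{R+2} ∖ Λ°_{r-2}` witnesses `A₁(r, R) = embArmEvent oneArmColour r R` (the
dual data of the event is trivial for the all-primal colouring; it needs a face, `Nonempty F`).
[cite: GrimmettManolescu2014Isoradial, §2.2 (arm events A_σ(N, n), σ = (1))] -/
theorem mem_embArmEvent_oneArm_of_walk' [Nonempty F] {ω : BondConfig V} {r R : ℕ} {x y : V}
    (w : (openGraph ω).Walk x y) (hx : (emb.z x).boxNorm ≤ r) (hy : (R : ℝ) ≤ (emb.z y).boxNorm)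
    (hsupp : ∀ v ∈ w.support, (emb.z v).boxNorm ∈ Icc ((r : ℝ) - 2) (R + 2)) :
    ω ∈ emb.embArmEvent oneArmColour r R := by
  simp only [RhombicEmbedding.embArmEvent, Set.mem_setOf_eq]
  refine ⟨fun _ => x, fun _ => y, fun _ => w, fun _ => Classical.arbitrary F,
    fun _ => Classical.arbitrary F, fun _ => SimpleGraph.Walk.nil, fun _ _ => ⟨hx, hy, hsupp⟩,
    fun j hj => absurd hj (by simp [oneArmColour]), fun i j hij => absurd (Subsingleton.elim i j) hij,
    fun i j hij => absurd (Subsingleton.elim i j) hij⟩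

/-- **Unpacking the one-arm event**: `A₁(r, R)` provides an open walk from `Λ_r` to
`{R ≤ ‖·‖_∞}` inside `Λ_{R+2} ∖ Λ°_{r-2}`. [cite: GrimmettManolescu2014Isoradial, §2.2 (arm events)] -/
theorem exists_walk_of_mem_embArmEvent_oneArm {ω : BondConfig V} {r R : ℕ}
    (h : ω ∈ emb.embArmEvent oneArmColour r R) :
    ∃ (x y : V) (w : (openGraph ω).Walk x y), (emb.z x).boxNorm ≤ r ∧ (R : ℝ) ≤ (emb.z y).boxNorm ∧
      ∀ v ∈ w.support, (emb.z v).boxNorm ∈ Icc ((r : ℝ) - 2) (R + 2) := by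
  simp only [RhombicEmbedding.embArmEvent, Set.mem_setOf_eq] at h
  obtain ⟨x, y, w, -, -, -, hprim, -, -, -⟩ := h
  exact ⟨x 0, y 0, w 0, hprim 0 rfl⟩

/-- **The one-arm event is an open crossing event**: `A₁(r, R)` is the event of an open crossing
from `Λ_r` to `{R ≤ ‖·‖_∞}` inside `Λ_{R+2} ∖ Λ°_{r-2}` (`Percolation.openCrossing`).
[cite: GrimmettManolescu2014Isoradial, §2.2 (arm events)] -/
theorem embArmEvent_oneArm_eq_openCrossing [Nonempty F] (r R : ℕ) :
    emb.embArmEvent oneArmColour r R =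
      openCrossing {v | (emb.z v).boxNorm ∈ Icc ((r : ℝ) - 2) (R + 2)}
        {v | (emb.z v).boxNorm ≤ r} {v | (R : ℝ) ≤ (emb.z v).boxNorm} := by
  ext ω
  constructor
  · intro h
    obtain ⟨x, y, w, hx, hy, hsupp⟩ := exists_walk_of_mem_embArmEvent_oneArm emb h
    exact ⟨x, hx, y, hy, mem_openConnIn_iff_exists_openWalk.2 ⟨w, hsupp⟩⟩
  · rintro ⟨x, hx, y, hy, hconn⟩
    obtain ⟨w, hw⟩ := mem_openConnIn_iff_exists_openWalk.1 hconn
    exact mem_embArmEvent_oneArm_of_walk' emb w hx hy hw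

/-- The one-arm event is increasing. [cite: GrimmettManolescu2014Isoradial, §8.5.2 (Harris–FKG for arm events)] -/
theorem isUpperSet_embArmEvent_oneArm [Nonempty F] (r R : ℕ) :
    IsUpperSet (emb.embArmEvent oneArmColour r R) := by
  rw [embArmEvent_oneArm_eq_openCrossing emb]
  exact isUpperSet_openCrossing _ _ _

/-- Open crossing events are measurable when the vertex type is countable (countable union of
the measurable events `{x ↔ y in S}`, `measurableSet_openConnIn_of_countable`). [folklore] -/
theorem measurableSet_openCrossing' [Countable V] (S A B : Set V) :
    MeasurableSet (openCrossing S A B : Set (BondConfig V)) := by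
  have h : openCrossing S A B = ⋃ x ∈ A, ⋃ y ∈ B, (openConnIn S x y : Set (BondConfig V)) := by
    ext ω
    simp only [mem_openCrossing_iff, Set.mem_iUnion, exists_prop]
  rw [h]
  exact MeasurableSet.biUnion (Set.to_countable A) fun x _ =>
    MeasurableSet.biUnion (Set.to_countable B) fun y _ => measurableSet_openConnIn_of_countable S x y

/-- The one-arm event is measurable. [folklore] -/
theorem measurableSet_embArmEvent_oneArm [Nonempty F] [Countable V] (r R : ℕ) :
    MeasurableSet (emb.embArmEvent oneArmColour r R) := by
  rw [embArmEvent_oneArm_eq_openCrossing emb]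
  exact measurableSet_openCrossing' _ _ _

/-- Rectangle crossing events are measurable. [folklore] -/
theorem measurableSet_embRectCrossing [Countable V] (z : V → ℂ) (a b : ℝ) :
    MeasurableSet (embRectCrossing z a b) :=
  measurableSet_openCrossing' _ _ _

/-- Vertical rectangle crossing events are measurable. [folklore] -/
theorem measurableSet_embTBCrossing [Countable V] (z : V → ℂ) (a b : ℝ) :
    MeasurableSet (embTBCrossing z a b) :=
  measurableSet_openCrossing' _ _ _

/-- **Normalising a walk into an arm.** An open walk (of a configuration `ω ⊆ E(G)`) from `Λ_r`
to `{R ≤ ‖·‖_∞}` all of whose vertices lie in `Λ_{R+2}` yields `A₁(r, R)`: restart it at its last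
visit to `Λ_r`; afterwards it stays outside `Λ_r`, and the restart vertex has sup norm `> r - 2`
because edges are shorter than `2`. (Last-exit decomposition, Grimmett–Manolescu 2014, §8.5.2.)
[cite: GrimmettManolescu2014Isoradial, §8.5.2 (last-exit decomposition of open paths)] -/
theorem mem_embArmEvent_oneArm_of_walk [Nonempty F] (hiso : emb.IsIsoradial) {ω : BondConfig V}
    (hω : ω ⊆ G.edgeSet) {r R : ℕ} (hrR : r ≤ R) {x y : V} (w : (openGraph ω).Walk x y)
    (hx : (emb.z x).boxNorm ≤ r) (hy : (R : ℝ) ≤ (emb.z y).boxNorm)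
    (hsupp : ∀ v ∈ w.support, (emb.z v).boxNorm ≤ R + 2) :
    ω ∈ emb.embArmEvent oneArmColour r R := by
  have hrRℝ : (r : ℝ) ≤ R := by exact_mod_cast hrR
  obtain ⟨x', q, h1, h2, h3⟩ := exists_walk_truncate (fun v => -(emb.z v).boxNorm) (-(r : ℝ))
    (fun a b hab => by
      have := emb.boxNorm_z_le_of_openGraph_adj hiso hω hab.symm
      linarith) w.reverse (by linarith) (by linarith)
  refine mem_embArmEvent_oneArm_of_walk' emb q.reverse (by linarith) hy fun v hv => ?_
  rw [SimpleGraph.Walk.support_reverse, List.mem_reverse] at hv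
  have hv' : v ∈ w.support := by
    have := h2 v hv
    rwa [SimpleGraph.Walk.support_reverse, List.mem_reverse] at this
  have := h3 v hv
  exact ⟨by linarith, hsupp v hv'⟩

/-! ### §2 Open connections along walks -/

/-- A vertex of an open walk inside `S` is joined inside `S` to both ends of the walk.
[folklore] -/
theorem openConnIn_of_mem_support [DecidableEq V] {ω : BondConfig V} {S : Set V} {x y : V}
    (w : (openGraph ω).Walk x y) (hS : ∀ v ∈ w.support, v ∈ S) {u : V} (hu : u ∈ w.support) :
    ω ∈ openConnIn S x u ∧ ω ∈ openConnIn S u y :=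
  ⟨mem_openConnIn_iff_exists_openWalk.2
      ⟨w.takeUntil u hu, fun v hv => hS v (w.support_takeUntil_subset_support hu hv)⟩,
    mem_openConnIn_iff_exists_openWalk.2
      ⟨w.dropUntil u hu, fun v hv => hS v (w.support_dropUntil_subset_support hu hv)⟩⟩

/-- Two vertices of an open walk inside `S` are joined inside `S`. [folklore] -/
theorem openConnIn_of_mem_support₂ [DecidableEq V] {ω : BondConfig V} {S : Set V} {x y : V}
    (w : (openGraph ω).Walk x y) (hS : ∀ v ∈ w.support, v ∈ S) {u u' : V} (hu : u ∈ w.support)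
    (hu' : u' ∈ w.support) : ω ∈ openConnIn S u u' := by
  have h1 := (openConnIn_of_mem_support w hS hu).1
  have h2 := (openConnIn_of_mem_support w hS hu').1
  rw [openConnIn_comm] at h1
  exact PlanarDuality.openConnIn_trans h1 h2

/-- Adjacency in the open graph of a configuration using only edges of `G` is adjacency in `G`.
[folklore] -/
theorem adj_of_openGraph_adj {ω : BondConfig V} (hω : ω ⊆ G.edgeSet) ⦃u v : V⦄
    (h : (openGraph ω).Adj u v) : G.Adj u v := by
  rw [openGraph_adj] at h
  exact hω h.1

/-! ### §3 Gluing: the arm, the radial crossing and the four strip crossings are in one cluster -/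

/-- **Everything hangs off the circuit.** In an isoradial rhombic tiling, let four open walks
(of a configuration `ω ⊆ E(G)`) cross the four strips of the square annulus `Λ_b ∖ Λ_a`
(`0 ≤ a < b`) the long way — `pt` the top strip `[-b, b] × [a, b]` and `pb` the bottom strip
`[-b, b] × [-b, -a]` from `{re ≤ -b}` to `{b ≤ re}`, `pl` the left strip `[-b, -a] × [-b, b]`
and `pr` the right strip `[a, b] × [-b, b]` from `{im ≤ -b}` to `{b ≤ im}` — and let `p` be
an open walk from `Λ_a` to `{b ≤ ‖·‖_∞}`, all with vertices in a set `S`. Then both ends of `p`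
are joined to the start of `pt` by open paths inside `S`. (The strip crossings pairwise meet
at the corners — `exists_mem_support_of_crossing_walks` — and `p` meets one of them —
`exists_mem_support_of_radial_walk`.) This is the deterministic core of the extension
arguments of Grimmett–Manolescu 2014, §8.5.2 (the circuit events `H_M`, `K_m`).
[cite: GrimmettManolescu2014Isoradial, §8.5.2 ("extension of paths by judiciously positioned box-crossings")] -/
theorem openConnIn_of_radial_of_strips [DecidableEq V] (hiso : emb.IsIsoradial)
    (hrh : emb.IsRhombicTiling) {ω : BondConfig V} (hω : ω ⊆ G.edgeSet) {a b : ℝ} (ha : 0 ≤ a)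
    (hab : a < b) {S : Set V} {x y : V} (p : (openGraph ω).Walk x y)
    (hx : (emb.z x).boxNorm ≤ a) (hy : b ≤ (emb.z y).boxNorm) (hpS : ∀ v ∈ p.support, v ∈ S)
    {xt yt xb yb xl yl xr yr : V} (pt : (openGraph ω).Walk xt yt) (pb : (openGraph ω).Walk xb yb)
    (pl : (openGraph ω).Walk xl yl) (pr : (openGraph ω).Walk xr yr)
    (hxt : (emb.z xt).re ≤ -b) (hyt : b ≤ (emb.z yt).re)
    (hst : ∀ v ∈ pt.support, (emb.z v).im ∈ Icc a b) (hptS : ∀ v ∈ pt.support, v ∈ S)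
    (hxb : (emb.z xb).re ≤ -b) (hyb : b ≤ (emb.z yb).re)
    (hsb : ∀ v ∈ pb.support, (emb.z v).im ∈ Icc (-b) (-a)) (hpbS : ∀ v ∈ pb.support, v ∈ S)
    (hxl : (emb.z xl).im ≤ -b) (hyl : b ≤ (emb.z yl).im)
    (hsl : ∀ v ∈ pl.support, (emb.z v).re ∈ Icc (-b) (-a)) (hplS : ∀ v ∈ pl.support, v ∈ S)
    (hxr : (emb.z xr).im ≤ -b) (hyr : b ≤ (emb.z yr).im)
    (hsr : ∀ v ∈ pr.support, (emb.z v).re ∈ Icc a b) (hprS : ∀ v ∈ pr.support, v ∈ S) :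
    ω ∈ openConnIn S xt x ∧ ω ∈ openConnIn S xt y := by
  have hAdj : ∀ ⦃u v : V⦄, (openGraph ω).Adj u v → G.Adj u v := adj_of_openGraph_adj hω
  have hb : 0 < b := lt_of_le_of_lt ha hab
  -- corners: `pt` meets `pl` and `pr`, `pb` meets `pl`
  obtain ⟨c₁, hc₁t, hc₁l⟩ := exists_mem_support_of_crossing_walks emb hiso hrh hAdj hAdj pt pl
    (a₁ := -b) (a₂ := -a) (b₁ := a) (b₂ := b) (by linarith) hab hxt (by linarith) hst
    (by linarith) hyl hsl
  obtain ⟨c₂, hc₂t, hc₂r⟩ := exists_mem_support_of_crossing_walks emb hiso hrh hAdj hAdj pt pr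
    (a₁ := a) (a₂ := b) (b₁ := a) (b₂ := b) hab hab (by linarith) hyt hst (by linarith) hyr hsr
  obtain ⟨c₃, hc₃b, hc₃l⟩ := exists_mem_support_of_crossing_walks emb hiso hrh hAdj hAdj pb pl
    (a₁ := -b) (a₂ := -a) (b₁ := -b) (b₂ := -a) (by linarith) (by linarith) hxb (by linarith) hsb
    hxl (by linarith) hsl
  -- every vertex of the four strip walks is joined to `xt` inside `S`
  have hl : ∀ v ∈ pl.support, ω ∈ openConnIn S xt v := fun v hv =>
    PlanarDuality.openConnIn_trans (openConnIn_of_mem_support pt hptS hc₁t).1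
      (openConnIn_of_mem_support₂ pl hplS hc₁l hv)
  have key : ∀ v, (v ∈ pt.support ∨ v ∈ pb.support ∨ v ∈ pl.support ∨ v ∈ pr.support) →
      ω ∈ openConnIn S xt v := by
    rintro v (hv | hv | hv | hv)
    · exact (openConnIn_of_mem_support pt hptS hv).1
    · exact PlanarDuality.openConnIn_trans (hl c₃ hc₃l) (openConnIn_of_mem_support₂ pb hpbS hc₃b hv)
    · exact hl v hv
    · exact PlanarDuality.openConnIn_trans (openConnIn_of_mem_support pt hptS hc₂t).1
        (openConnIn_of_mem_support₂ pr hprS hc₂r hv)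
  -- the radial walk meets one of them
  obtain ⟨u, hu, hu'⟩ := exists_mem_support_of_radial_walk emb hiso hrh hAdj hAdj ha hab p hx hy
    pt pb pl pr hxt hyt hst hxb hyb hsb hxl hyl hsl hxr hyr hsr
  have hxu := key u hu'
  obtain ⟨h1, h2⟩ := openConnIn_of_mem_support p hpS hu
  rw [openConnIn_comm] at h1
  exact ⟨PlanarDuality.openConnIn_trans hxu h1, PlanarDuality.openConnIn_trans hxu h2⟩

/-- Sup-norm bound from coordinate bounds. [folklore] -/
theorem boxNorm_le_of_abs_le {w : ℂ} {t : ℝ} (hre : |w.re| ≤ t) (him : |w.im| ≤ t) :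
    w.boxNorm ≤ t :=
  max_le hre him

/-- **Inward extension of one arm (deterministic part).** Let `N ≥ 2`, `n ≥ 4N`, and let
`ω ⊆ E(G)` be a configuration of an isoradial rhombic tiling in which `A₁(2N, n)` occurs, the
four `8N × 2N` strips of `Λ_{4N} ∖ Λ_{2N}` are crossed the long way (rendered crossing events
`embRectCrossing` / `embTBCrossing` of the translated rectangles, exactly as produced by
`BoxCrossingBounds` at aspect ratio `4` and scale `2N`), and the rectangle `[0, 4N] × [-N/2, N/2]`
is crossed horizontally (scale `N`). Then `A₁(N, n)` occurs. (Grimmett–Manolescu 2014, §8.2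
Prop. (exp_equiv) (b), second inequality, `k = 1`: "the extension of paths by judiciously
positioned box-crossings", §8.5.2.)
[cite: GrimmettManolescu2014Isoradial, §8.2 Prop. (exp_equiv) (b) with §8.5.2] -/
theorem mem_embArmEvent_of_inward [Nonempty F] [DecidableEq V] (hiso : emb.IsIsoradial)
    (hrh : emb.IsRhombicTiling) {ω : BondConfig V} (hω : ω ⊆ G.edgeSet) {N n : ℕ} (hN : 2 ≤ N)
    (hn : 4 * N ≤ n) (harm : ω ∈ emb.embArmEvent oneArmColour (2 * N) n)
    (ht : ω ∈ embRectCrossing (fun v => emb.z v - Complex.mk (-(4 * N)) (2 * N))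
      (4 * ((2 * N : ℕ) : ℝ)) ((2 * N : ℕ) : ℝ))
    (hb : ω ∈ embRectCrossing (fun v => emb.z v - Complex.mk (-(4 * N)) (-(4 * N)))
      (4 * ((2 * N : ℕ) : ℝ)) ((2 * N : ℕ) : ℝ))
    (hl : ω ∈ embTBCrossing (fun v => emb.z v - Complex.mk (-(4 * N)) (-(4 * N)))
      ((2 * N : ℕ) : ℝ) (4 * ((2 * N : ℕ) : ℝ)))
    (hr : ω ∈ embTBCrossing (fun v => emb.z v - Complex.mk (2 * N) (-(4 * N)))
      ((2 * N : ℕ) : ℝ) (4 * ((2 * N : ℕ) : ℝ)))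
    (hrad : ω ∈ embRectCrossing (fun v => emb.z v - Complex.mk 0 (-(N / 2)))
      (4 * (N : ℝ)) (N : ℝ)) :
    ω ∈ emb.embArmEvent oneArmColour N n := by
  have hNℝ : (2 : ℝ) ≤ N := by exact_mod_cast hN
  have hnℝ : 4 * (N : ℝ) ≤ n := by exact_mod_cast hn
  have hcast : ((2 * N : ℕ) : ℝ) = 2 * N := by push_cast; ring
  rw [hcast] at ht hb hl hr
  set S : Set V := {v | (emb.z v).boxNorm ≤ n + 2} with hS
  -- the arm
  obtain ⟨xa, ya, pa, hxa, hya, hsa⟩ := exists_walk_of_mem_embArmEvent_oneArm emb harm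
  have hxa' : (emb.z xa).boxNorm ≤ 2 * N := by exact_mod_cast hxa
  -- the four strip crossings
  obtain ⟨xt, yt, pt, hxt, hyt, hst⟩ := mem_embRectCrossing_iff_holds.1 ht
  obtain ⟨xb, yb, pb, hxb, hyb, hsb⟩ := mem_embRectCrossing_iff_holds.1 hb
  obtain ⟨xl, hxl, yl, hyl, hcl⟩ := hl
  obtain ⟨pl, hsl⟩ := mem_openConnIn_iff_exists_openWalk.1 hcl
  obtain ⟨xr, hxr, yr, hyr, hcr⟩ := hr
  obtain ⟨pr, hsr⟩ := mem_openConnIn_iff_exists_openWalk.1 hcr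
  -- the radial crossing
  obtain ⟨x₀, y₀, p₀, hx₀, hy₀, hs₀⟩ := mem_embRectCrossing_iff_holds.1 hrad
  simp only [Set.mem_setOf_eq, Complex.sub_re, Complex.sub_im, mem_Icc] at hxl hyl hsl hxr hyr hsr
  simp only [Complex.sub_re, Complex.sub_im, mem_Icc] at hxt hyt hst hxb hyb hsb hx₀ hy₀ hs₀
  -- apply the gluing theorem with `a = 2N`, `b = 4N`
  have key := openConnIn_of_radial_of_strips emb hiso hrh hω (a := 2 * N) (b := 4 * N) (S := S)
    (by linarith) (by linarith) p₀
    (boxNorm_le_of_abs_le (abs_le.2 ⟨by linarith [(hs₀ x₀ p₀.start_mem_support).1.1], by linarith⟩)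
      (abs_le.2 ⟨by linarith [(hs₀ x₀ p₀.start_mem_support).2.1],
        by linarith [(hs₀ x₀ p₀.start_mem_support).2.2]⟩))
    (le_trans (by linarith) ((le_abs_self _).trans (IsoradialCriticality.abs_re_le_boxNorm (emb.z y₀))))
    (fun v hv => by
      have h := hs₀ v hv
      exact boxNorm_le_of_abs_le (abs_le.2 ⟨by linarith [h.1.1], by linarith [h.1.2]⟩)
        (abs_le.2 ⟨by linarith [h.2.1], by linarith [h.2.2]⟩))
    pt pb pl pr (by linarith) (by linarith)
    (fun v hv => ⟨by linarith [(hst v hv).2.1], by linarith [(hst v hv).2.2]⟩)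
    (fun v hv => by
      have h := hst v hv
      exact boxNorm_le_of_abs_le (abs_le.2 ⟨by linarith [h.1.1], by linarith [h.1.2]⟩)
        (abs_le.2 ⟨by linarith [h.2.1], by linarith [h.2.2]⟩))
    (by linarith) (by linarith)
    (fun v hv => ⟨by linarith [(hsb v hv).2.1], by linarith [(hsb v hv).2.2]⟩)
    (fun v hv => by
      have h := hsb v hv
      exact boxNorm_le_of_abs_le (abs_le.2 ⟨by linarith [h.1.1], by linarith [h.1.2]⟩)
        (abs_le.2 ⟨by linarith [h.2.1], by linarith [h.2.2]⟩))
    (by linarith) (by linarith)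
    (fun v hv => ⟨by linarith [(hsl v hv).1.1], by linarith [(hsl v hv).1.2]⟩)
    (fun v hv => by
      have h := hsl v hv
      exact boxNorm_le_of_abs_le (abs_le.2 ⟨by linarith [h.1.1], by linarith [h.1.2]⟩)
        (abs_le.2 ⟨by linarith [h.2.1], by linarith [h.2.2]⟩))
    (by linarith) (by linarith)
    (fun v hv => ⟨by linarith [(hsr v hv).1.1], by linarith [(hsr v hv).1.2]⟩)
    (fun v hv => by
      have h := hsr v hv
      exact boxNorm_le_of_abs_le (abs_le.2 ⟨by linarith [h.1.1], by linarith [h.1.2]⟩)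
        (abs_le.2 ⟨by linarith [h.2.1], by linarith [h.2.2]⟩))
  -- and once more with the arm as the radial walk
  have key' := openConnIn_of_radial_of_strips emb hiso hrh hω (a := 2 * N) (b := 4 * N) (S := S)
    (by linarith) (by linarith) pa hxa' (le_trans hnℝ hya) (fun v hv => (hsa v hv).2)
    pt pb pl pr (by linarith) (by linarith)
    (fun v hv => ⟨by linarith [(hst v hv).2.1], by linarith [(hst v hv).2.2]⟩)
    (fun v hv => by
      have h := hst v hv
      exact boxNorm_le_of_abs_le (abs_le.2 ⟨by linarith [h.1.1], by linarith [h.1.2]⟩)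
        (abs_le.2 ⟨by linarith [h.2.1], by linarith [h.2.2]⟩))
    (by linarith) (by linarith)
    (fun v hv => ⟨by linarith [(hsb v hv).2.1], by linarith [(hsb v hv).2.2]⟩)
    (fun v hv => by
      have h := hsb v hv
      exact boxNorm_le_of_abs_le (abs_le.2 ⟨by linarith [h.1.1], by linarith [h.1.2]⟩)
        (abs_le.2 ⟨by linarith [h.2.1], by linarith [h.2.2]⟩))
    (by linarith) (by linarith)
    (fun v hv => ⟨by linarith [(hsl v hv).1.1], by linarith [(hsl v hv).1.2]⟩)
    (fun v hv => by
      have h := hsl v hv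
      exact boxNorm_le_of_abs_le (abs_le.2 ⟨by linarith [h.1.1], by linarith [h.1.2]⟩)
        (abs_le.2 ⟨by linarith [h.2.1], by linarith [h.2.2]⟩))
    (by linarith) (by linarith)
    (fun v hv => ⟨by linarith [(hsr v hv).1.1], by linarith [(hsr v hv).1.2]⟩)
    (fun v hv => by
      have h := hsr v hv
      exact boxNorm_le_of_abs_le (abs_le.2 ⟨by linarith [h.1.1], by linarith [h.1.2]⟩)
        (abs_le.2 ⟨by linarith [h.2.1], by linarith [h.2.2]⟩))
  -- `x₀ ↔ xt ↔ ya` inside `S`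
  have hconn : ω ∈ openConnIn S x₀ ya := by
    have h1 := key.1
    rw [openConnIn_comm] at h1
    exact PlanarDuality.openConnIn_trans h1 key'.2
  obtain ⟨w, hw⟩ := mem_openConnIn_iff_exists_openWalk.1 hconn
  refine mem_embArmEvent_oneArm_of_walk emb hiso hω (by omega) w ?_ hya hw
  have h0 := hs₀ x₀ p₀.start_mem_support
  exact boxNorm_le_of_abs_le (abs_le.2 ⟨by linarith [h0.1.1], by linarith⟩)
    (abs_le.2 ⟨by linarith [h0.2.1], by linarith [h0.2.2]⟩)

/-- **Outward extension of one arm (deterministic part).** Let `m ≥ 2`, `N ≤ m`, and let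
`ω ⊆ E(G)` be a configuration of an isoradial rhombic tiling in which `A₁(N, 2m)` occurs, the
four `4m × m` strips of `Λ_{2m} ∖ Λ_m` are crossed the long way (scale `m`, aspect ratio `4`)
and the rectangle `[0, 4m] × [-m/2, m/2]` is crossed horizontally. Then `A₁(N, 4m)` occurs.
(Grimmett–Manolescu 2014, §8.2 Prop. (exp_equiv) (a), second inequality, `k = 1`.)
[cite: GrimmettManolescu2014Isoradial, §8.2 Prop. (exp_equiv) (a) with §8.5.2] -/
theorem mem_embArmEvent_of_outward [Nonempty F] [DecidableEq V] (hiso : emb.IsIsoradial)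
    (hrh : emb.IsRhombicTiling) {ω : BondConfig V} (hω : ω ⊆ G.edgeSet) {N m : ℕ} (hm : 2 ≤ m)
    (hNm : N ≤ m) (harm : ω ∈ emb.embArmEvent oneArmColour N (2 * m))
    (ht : ω ∈ embRectCrossing (fun v => emb.z v - Complex.mk (-(2 * m)) m) (4 * (m : ℝ)) (m : ℝ))
    (hb : ω ∈ embRectCrossing (fun v => emb.z v - Complex.mk (-(2 * m)) (-(2 * m)))
      (4 * (m : ℝ)) (m : ℝ))
    (hl : ω ∈ embTBCrossing (fun v => emb.z v - Complex.mk (-(2 * m)) (-(2 * m)))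
      (m : ℝ) (4 * (m : ℝ)))
    (hr : ω ∈ embTBCrossing (fun v => emb.z v - Complex.mk m (-(2 * m))) (m : ℝ) (4 * (m : ℝ)))
    (hrad : ω ∈ embRectCrossing (fun v => emb.z v - Complex.mk 0 (-(m / 2))) (4 * (m : ℝ)) (m : ℝ)) :
    ω ∈ emb.embArmEvent oneArmColour N (4 * m) := by
  have hmℝ : (2 : ℝ) ≤ m := by exact_mod_cast hm
  have hNmℝ : (N : ℝ) ≤ m := by exact_mod_cast hNm
  set S : Set V := {v | (emb.z v).boxNorm ≤ (4 * m : ℕ) + 2} with hS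
  have hcast4 : ((4 * m : ℕ) : ℝ) = 4 * m := by push_cast; ring
  -- the arm
  obtain ⟨xa, ya, pa, hxa, hya, hsa⟩ := exists_walk_of_mem_embArmEvent_oneArm emb harm
  have hcast2 : ((2 * m : ℕ) : ℝ) = 2 * m := by push_cast; ring
  rw [hcast2] at hya hsa
  -- the four strip crossings
  obtain ⟨xt, yt, pt, hxt, hyt, hst⟩ := mem_embRectCrossing_iff_holds.1 ht
  obtain ⟨xb, yb, pb, hxb, hyb, hsb⟩ := mem_embRectCrossing_iff_holds.1 hb
  obtain ⟨xl, hxl, yl, hyl, hcl⟩ := hl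
  obtain ⟨pl, hsl⟩ := mem_openConnIn_iff_exists_openWalk.1 hcl
  obtain ⟨xr, hxr, yr, hyr, hcr⟩ := hr
  obtain ⟨pr, hsr⟩ := mem_openConnIn_iff_exists_openWalk.1 hcr
  -- the radial crossing
  obtain ⟨x₀, y₀, p₀, hx₀, hy₀, hs₀⟩ := mem_embRectCrossing_iff_holds.1 hrad
  simp only [Set.mem_setOf_eq, Complex.sub_re, Complex.sub_im, mem_Icc] at hxl hyl hsl hxr hyr hsr
  simp only [Complex.sub_re, Complex.sub_im, mem_Icc] at hxt hyt hst hxb hyb hsb hx₀ hy₀ hs₀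
  -- apply the gluing theorem with `a = m`, `b = 2m`, to the radial crossing
  have key := openConnIn_of_radial_of_strips emb hiso hrh hω (a := m) (b := 2 * m) (S := S)
    (by linarith) (by linarith) p₀
    (boxNorm_le_of_abs_le (abs_le.2 ⟨by linarith [(hs₀ x₀ p₀.start_mem_support).1.1], by linarith⟩)
      (abs_le.2 ⟨by linarith [(hs₀ x₀ p₀.start_mem_support).2.1],
        by linarith [(hs₀ x₀ p₀.start_mem_support).2.2]⟩))
    (le_trans (by linarith) ((le_abs_self _).trans (IsoradialCriticality.abs_re_le_boxNorm (emb.z y₀))))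
    (fun v hv => by
      have h := hs₀ v hv
      rw [hS, Set.mem_setOf_eq, hcast4]
      exact boxNorm_le_of_abs_le (abs_le.2 ⟨by linarith [h.1.1], by linarith [h.1.2]⟩)
        (abs_le.2 ⟨by linarith [h.2.1], by linarith [h.2.2]⟩))
    pt pb pl pr (by linarith) (by linarith)
    (fun v hv => ⟨by linarith [(hst v hv).2.1], by linarith [(hst v hv).2.2]⟩)
    (fun v hv => by
      have h := hst v hv
      rw [hS, Set.mem_setOf_eq, hcast4]
      exact boxNorm_le_of_abs_le (abs_le.2 ⟨by linarith [h.1.1], by linarith [h.1.2]⟩)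
        (abs_le.2 ⟨by linarith [h.2.1], by linarith [h.2.2]⟩))
    (by linarith) (by linarith)
    (fun v hv => ⟨by linarith [(hsb v hv).2.1], by linarith [(hsb v hv).2.2]⟩)
    (fun v hv => by
      have h := hsb v hv
      rw [hS, Set.mem_setOf_eq, hcast4]
      exact boxNorm_le_of_abs_le (abs_le.2 ⟨by linarith [h.1.1], by linarith [h.1.2]⟩)
        (abs_le.2 ⟨by linarith [h.2.1], by linarith [h.2.2]⟩))
    (by linarith) (by linarith)
    (fun v hv => ⟨by linarith [(hsl v hv).1.1], by linarith [(hsl v hv).1.2]⟩)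
    (fun v hv => by
      have h := hsl v hv
      rw [hS, Set.mem_setOf_eq, hcast4]
      exact boxNorm_le_of_abs_le (abs_le.2 ⟨by linarith [h.1.1], by linarith [h.1.2]⟩)
        (abs_le.2 ⟨by linarith [h.2.1], by linarith [h.2.2]⟩))
    (by linarith) (by linarith)
    (fun v hv => ⟨by linarith [(hsr v hv).1.1], by linarith [(hsr v hv).1.2]⟩)
    (fun v hv => by
      have h := hsr v hv
      rw [hS, Set.mem_setOf_eq, hcast4]
      exact boxNorm_le_of_abs_le (abs_le.2 ⟨by linarith [h.1.1], by linarith [h.1.2]⟩)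
        (abs_le.2 ⟨by linarith [h.2.1], by linarith [h.2.2]⟩))
  -- and to the arm
  have key' := openConnIn_of_radial_of_strips emb hiso hrh hω (a := m) (b := 2 * m) (S := S)
    (by linarith) (by linarith) pa (hxa.trans hNmℝ) hya
    (fun v hv => by
      rw [hS, Set.mem_setOf_eq, hcast4]
      linarith [(hsa v hv).2])
    pt pb pl pr (by linarith) (by linarith)
    (fun v hv => ⟨by linarith [(hst v hv).2.1], by linarith [(hst v hv).2.2]⟩)
    (fun v hv => by
      have h := hst v hv
      rw [hS, Set.mem_setOf_eq, hcast4]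
      exact boxNorm_le_of_abs_le (abs_le.2 ⟨by linarith [h.1.1], by linarith [h.1.2]⟩)
        (abs_le.2 ⟨by linarith [h.2.1], by linarith [h.2.2]⟩))
    (by linarith) (by linarith)
    (fun v hv => ⟨by linarith [(hsb v hv).2.1], by linarith [(hsb v hv).2.2]⟩)
    (fun v hv => by
      have h := hsb v hv
      rw [hS, Set.mem_setOf_eq, hcast4]
      exact boxNorm_le_of_abs_le (abs_le.2 ⟨by linarith [h.1.1], by linarith [h.1.2]⟩)
        (abs_le.2 ⟨by linarith [h.2.1], by linarith [h.2.2]⟩))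
    (by linarith) (by linarith)
    (fun v hv => ⟨by linarith [(hsl v hv).1.1], by linarith [(hsl v hv).1.2]⟩)
    (fun v hv => by
      have h := hsl v hv
      rw [hS, Set.mem_setOf_eq, hcast4]
      exact boxNorm_le_of_abs_le (abs_le.2 ⟨by linarith [h.1.1], by linarith [h.1.2]⟩)
        (abs_le.2 ⟨by linarith [h.2.1], by linarith [h.2.2]⟩))
    (by linarith) (by linarith)
    (fun v hv => ⟨by linarith [(hsr v hv).1.1], by linarith [(hsr v hv).1.2]⟩)
    (fun v hv => by
      have h := hsr v hv
      rw [hS, Set.mem_setOf_eq, hcast4]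
      exact boxNorm_le_of_abs_le (abs_le.2 ⟨by linarith [h.1.1], by linarith [h.1.2]⟩)
        (abs_le.2 ⟨by linarith [h.2.1], by linarith [h.2.2]⟩))
  -- `xa ↔ xt ↔ y₀` inside `S`
  have hconn : ω ∈ openConnIn S xa y₀ := by
    have h1 := key'.1
    rw [openConnIn_comm] at h1
    exact PlanarDuality.openConnIn_trans h1 key.2
  obtain ⟨w, hw⟩ := mem_openConnIn_iff_exists_openWalk.1 hconn
  refine mem_embArmEvent_oneArm_of_walk emb hiso hω (by omega) w hxa ?_ ?_
  · rw [hcast4]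
    exact le_trans (by linarith) ((le_abs_self _).trans (IsoradialCriticality.abs_re_le_boxNorm _))
  · intro v hv
    exact hw v hv

/-! ### §4 Probability: Harris' inequality and the box-crossing lower bounds -/

/-- Harris' inequality for the canonical measure: increasing measurable events are positively
correlated (`prodBernoulli_harris`; `P_G` is a product measure).
[cite: GrimmettManolescu2014Isoradial, §8.5.2 (Harris–FKG inequality)] -/
theorem real_mul_real_le_real_inter {A B : Set (BondConfig V)} (hA : IsUpperSet A)
    (hB : IsUpperSet B) (hAm : MeasurableSet A) (hBm : MeasurableSet B) :
    emb.isoradialPercolation.real A * emb.isoradialPercolation.real B ≤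
      emb.isoradialPercolation.real (A ∩ B) :=
  prodBernoulli_harris emb.edgeWeight hA hB hAm hBm

/-- One Harris step with a lower bound on the second event: `P(A) · c ≤ P(A ∩ B)` when
`c ≤ P(B)`. [cite: GrimmettManolescu2014Isoradial, §8.5.2 (Harris–FKG inequality)] -/
theorem real_mul_le_real_inter {A B : Set (BondConfig V)} (hA : IsUpperSet A)
    (hB : IsUpperSet B) (hAm : MeasurableSet A) (hBm : MeasurableSet B) {c : ℝ}
    (hBc : c ≤ emb.isoradialPercolation.real B) :
    emb.isoradialPercolation.real A * c ≤ emb.isoradialPercolation.real (A ∩ B) :=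
  (mul_le_mul_of_nonneg_left hBc measureReal_nonneg).trans
    (real_mul_real_le_real_inter emb hA hB hAm hBm)

/-- **Prop. (exp_equiv) (b), second inequality, for one arm, under the box-crossing bounds.**
If the canonical measure of an isoradial rhombic tiling satisfies the box-crossing bounds at
aspect ratio `4` with constant `c` beyond the scale `n₀` (`BoxCrossingBounds P_G z 4 c n₀`), then
`c⁵ · P_G[A₁(2N, n)] ≤ P_G[A₁(N, n)]` for all `N ≥ n₀ ⊔ 2` and `n ≥ 4N`: six increasing events
(the arm, four strip crossings, one radial crossing) glued by `mem_embArmEvent_of_inward`, and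
Harris' inequality. (Grimmett–Manolescu 2014, §8.2 Prop. (exp_equiv) (b): "`P_G[A_k(2N, n)] ≤
c₂ P_G[A_k(N, n)]`", `k = 1`, with `c₂ = c⁻⁵`; the source, §8.5.2: "(a) and (b) follow from
Theorem (separation) and the box-crossing property … the extension of paths by judiciously
positioned box-crossings".)
[cite: GrimmettManolescu2014Isoradial, §8.2 Prop. (exp_equiv) (b), second inequality (k = 1)] -/
theorem embArmProb_inward [Nonempty F] [Countable V] [DecidableEq V] (hiso : emb.IsIsoradial)
    (hrh : emb.IsRhombicTiling) {c : ℝ} {n₀ : ℕ}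
    (hbxp : BoxCrossingBounds emb.isoradialPercolation emb.z 4 c n₀) {N n : ℕ} (hn₀ : n₀ ≤ N)
    (hN : 2 ≤ N) (hn : 4 * N ≤ n) :
    c ^ 5 * emb.embArmProb oneArmColour (2 * N) n ≤ emb.embArmProb oneArmColour N n := by
  rcases le_or_gt c 0 with hc | hc
  · have h5 : c ^ 5 ≤ 0 := Odd.pow_nonpos ⟨2, by norm_num⟩ hc
    have h0 := emb.embArmProb_nonneg oneArmColour (2 * N) n
    have h0' := emb.embArmProb_nonneg oneArmColour N n
    nlinarith
  -- the six events
  set A := emb.embArmEvent oneArmColour (2 * N) n with hA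
  set Et := embRectCrossing (fun v => emb.z v - Complex.mk (-(4 * N)) (2 * N))
    (4 * ((2 * N : ℕ) : ℝ)) ((2 * N : ℕ) : ℝ) with hEt
  set Eb := embRectCrossing (fun v => emb.z v - Complex.mk (-(4 * N)) (-(4 * N)))
    (4 * ((2 * N : ℕ) : ℝ)) ((2 * N : ℕ) : ℝ) with hEb
  set El := embTBCrossing (fun v => emb.z v - Complex.mk (-(4 * N)) (-(4 * N)))
    ((2 * N : ℕ) : ℝ) (4 * ((2 * N : ℕ) : ℝ)) with hEl
  set Er := embTBCrossing (fun v => emb.z v - Complex.mk (2 * N) (-(4 * N)))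
    ((2 * N : ℕ) : ℝ) (4 * ((2 * N : ℕ) : ℝ)) with hEr
  set E₀ := embRectCrossing (fun v => emb.z v - Complex.mk 0 (-(N / 2))) (4 * (N : ℝ)) (N : ℝ)
    with hE₀
  -- their probabilities are at least `c`
  have hbN := hbxp (2 * N) (by omega)
  have ht : c ≤ emb.isoradialPercolation.real Et := (hbN (Complex.mk (-(4 * N)) (2 * N))).1.1
  have hb : c ≤ emb.isoradialPercolation.real Eb := (hbN (Complex.mk (-(4 * N)) (-(4 * N)))).1.1
  have hl : c ≤ emb.isoradialPercolation.real El := (hbN (Complex.mk (-(4 * N)) (-(4 * N)))).2.1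
  have hr : c ≤ emb.isoradialPercolation.real Er := (hbN (Complex.mk (2 * N) (-(4 * N)))).2.1
  have h₀ : c ≤ emb.isoradialPercolation.real E₀ := (hbxp N hn₀ (Complex.mk 0 (-(N / 2)))).1.1
  -- they are increasing and measurable
  have hAu : IsUpperSet A := isUpperSet_embArmEvent_oneArm emb _ _
  have hAm : MeasurableSet A := measurableSet_embArmEvent_oneArm emb _ _
  have hEtu : IsUpperSet Et := isUpperSet_embRectCrossing _ _ _
  have hEtm : MeasurableSet Et := measurableSet_embRectCrossing _ _ _
  have hEbu : IsUpperSet Eb := isUpperSet_embRectCrossing _ _ _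
  have hEbm : MeasurableSet Eb := measurableSet_embRectCrossing _ _ _
  have hElu : IsUpperSet El := isUpperSet_embTBCrossing _ _ _
  have hElm : MeasurableSet El := measurableSet_embTBCrossing _ _ _
  have hEru : IsUpperSet Er := isUpperSet_embTBCrossing _ _ _
  have hErm : MeasurableSet Er := measurableSet_embTBCrossing _ _ _
  have hE₀u : IsUpperSet E₀ := isUpperSet_embRectCrossing _ _ _
  have hE₀m : MeasurableSet E₀ := measurableSet_embRectCrossing _ _ _
  -- Harris, five times
  have h1 := real_mul_le_real_inter emb hAu hEtu hAm hEtm ht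
  have h2 := real_mul_le_real_inter emb (hAu.inter hEtu) hEbu (hAm.inter hEtm) hEbm hb
  have h3 := real_mul_le_real_inter emb ((hAu.inter hEtu).inter hEbu) hElu
    ((hAm.inter hEtm).inter hEbm) hElm hl
  have h4 := real_mul_le_real_inter emb (((hAu.inter hEtu).inter hEbu).inter hElu) hEru
    (((hAm.inter hEtm).inter hEbm).inter hElm) hErm hr
  have h5 := real_mul_le_real_inter emb ((((hAu.inter hEtu).inter hEbu).inter hElu).inter hEru)
    hE₀u ((((hAm.inter hEtm).inter hEbm).inter hElm).inter hErm) hE₀m h₀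
  -- the glued event is contained in `A₁(N, n)` up to null configurations
  have hsub : (A ∩ Et ∩ Eb ∩ El ∩ Er ∩ E₀) ∩ {ω | ω ⊆ G.edgeSet} ⊆
      emb.embArmEvent oneArmColour N n := by
    rintro ω ⟨⟨⟨⟨⟨⟨hA', ht'⟩, hb'⟩, hl'⟩, hr'⟩, h₀'⟩, hω⟩
    exact mem_embArmEvent_of_inward emb hiso hrh hω hN hn hA' ht' hb' hl' hr' h₀'
  have hfin := emb.real_le_real_of_inter_subset hsub
  have hPA : 0 ≤ emb.isoradialPercolation.real A := measureReal_nonneg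
  calc c ^ 5 * emb.embArmProb oneArmColour (2 * N) n
      = emb.isoradialPercolation.real A * c * c * c * c * c := by
        rw [hA, RhombicEmbedding.embArmProb]; ring
    _ ≤ emb.isoradialPercolation.real (A ∩ Et) * c * c * c * c := by gcongr
    _ ≤ emb.isoradialPercolation.real (A ∩ Et ∩ Eb) * c * c * c := by gcongr
    _ ≤ emb.isoradialPercolation.real (A ∩ Et ∩ Eb ∩ El) * c * c := by gcongr
    _ ≤ emb.isoradialPercolation.real (A ∩ Et ∩ Eb ∩ El ∩ Er) * c := by gcongr
    _ ≤ emb.isoradialPercolation.real (A ∩ Et ∩ Eb ∩ El ∩ Er ∩ E₀) := h5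
    _ ≤ emb.embArmProb oneArmColour N n := hfin

/-- **Prop. (exp_equiv) (a), second inequality, for one arm, under the box-crossing bounds**
(scale form): `c⁵ · P_G[A₁(N, 2m)] ≤ P_G[A₁(N, 4m)]` for `m ≥ n₀ ⊔ 2 ⊔ N`, by the outward
gluing `mem_embArmEvent_of_outward` and Harris' inequality. (Grimmett–Manolescu 2014, §8.2
Prop. (exp_equiv) (a): "`P_G[A_k(N, n)] ≤ c₁ P_G[A_k(N, 2n)]`", `k = 1`.)
[cite: GrimmettManolescu2014Isoradial, §8.2 Prop. (exp_equiv) (a), second inequality (k = 1)] -/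
theorem embArmProb_outward [Nonempty F] [Countable V] [DecidableEq V] (hiso : emb.IsIsoradial)
    (hrh : emb.IsRhombicTiling) {c : ℝ} {n₀ : ℕ}
    (hbxp : BoxCrossingBounds emb.isoradialPercolation emb.z 4 c n₀) {N m : ℕ} (hm₀ : n₀ ≤ m)
    (hm : 2 ≤ m) (hNm : N ≤ m) :
    c ^ 5 * emb.embArmProb oneArmColour N (2 * m) ≤ emb.embArmProb oneArmColour N (4 * m) := by
  rcases le_or_gt c 0 with hc | hc
  · have h5 : c ^ 5 ≤ 0 := Odd.pow_nonpos ⟨2, by norm_num⟩ hc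
    have h0 := emb.embArmProb_nonneg oneArmColour N (2 * m)
    have h0' := emb.embArmProb_nonneg oneArmColour N (4 * m)
    nlinarith
  set A := emb.embArmEvent oneArmColour N (2 * m) with hA
  set Et := embRectCrossing (fun v => emb.z v - Complex.mk (-(2 * m)) m) (4 * (m : ℝ)) (m : ℝ)
    with hEt
  set Eb := embRectCrossing (fun v => emb.z v - Complex.mk (-(2 * m)) (-(2 * m)))
    (4 * (m : ℝ)) (m : ℝ) with hEb
  set El := embTBCrossing (fun v => emb.z v - Complex.mk (-(2 * m)) (-(2 * m)))
    (m : ℝ) (4 * (m : ℝ)) with hEl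
  set Er := embTBCrossing (fun v => emb.z v - Complex.mk m (-(2 * m))) (m : ℝ) (4 * (m : ℝ))
    with hEr
  set E₀ := embRectCrossing (fun v => emb.z v - Complex.mk 0 (-(m / 2))) (4 * (m : ℝ)) (m : ℝ)
    with hE₀
  have hbm := hbxp m hm₀
  have ht : c ≤ emb.isoradialPercolation.real Et := (hbm (Complex.mk (-(2 * m)) m)).1.1
  have hb : c ≤ emb.isoradialPercolation.real Eb := (hbm (Complex.mk (-(2 * m)) (-(2 * m)))).1.1
  have hl : c ≤ emb.isoradialPercolation.real El := (hbm (Complex.mk (-(2 * m)) (-(2 * m)))).2.1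
  have hr : c ≤ emb.isoradialPercolation.real Er := (hbm (Complex.mk m (-(2 * m)))).2.1
  have h₀ : c ≤ emb.isoradialPercolation.real E₀ := (hbm (Complex.mk 0 (-(m / 2)))).1.1
  have hAu : IsUpperSet A := isUpperSet_embArmEvent_oneArm emb _ _
  have hAm : MeasurableSet A := measurableSet_embArmEvent_oneArm emb _ _
  have hEtu : IsUpperSet Et := isUpperSet_embRectCrossing _ _ _
  have hEtm : MeasurableSet Et := measurableSet_embRectCrossing _ _ _
  have hEbu : IsUpperSet Eb := isUpperSet_embRectCrossing _ _ _
  have hEbm : MeasurableSet Eb := measurableSet_embRectCrossing _ _ _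
  have hElu : IsUpperSet El := isUpperSet_embTBCrossing _ _ _
  have hElm : MeasurableSet El := measurableSet_embTBCrossing _ _ _
  have hEru : IsUpperSet Er := isUpperSet_embTBCrossing _ _ _
  have hErm : MeasurableSet Er := measurableSet_embTBCrossing _ _ _
  have hE₀u : IsUpperSet E₀ := isUpperSet_embRectCrossing _ _ _
  have hE₀m : MeasurableSet E₀ := measurableSet_embRectCrossing _ _ _
  have h1 := real_mul_le_real_inter emb hAu hEtu hAm hEtm ht
  have h2 := real_mul_le_real_inter emb (hAu.inter hEtu) hEbu (hAm.inter hEtm) hEbm hb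
  have h3 := real_mul_le_real_inter emb ((hAu.inter hEtu).inter hEbu) hElu
    ((hAm.inter hEtm).inter hEbm) hElm hl
  have h4 := real_mul_le_real_inter emb (((hAu.inter hEtu).inter hEbu).inter hElu) hEru
    (((hAm.inter hEtm).inter hEbm).inter hElm) hErm hr
  have h5 := real_mul_le_real_inter emb ((((hAu.inter hEtu).inter hEbu).inter hElu).inter hEru)
    hE₀u ((((hAm.inter hEtm).inter hEbm).inter hElm).inter hErm) hE₀m h₀
  have hsub : (A ∩ Et ∩ Eb ∩ El ∩ Er ∩ E₀) ∩ {ω | ω ⊆ G.edgeSet} ⊆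
      emb.embArmEvent oneArmColour N (4 * m) := by
    rintro ω ⟨⟨⟨⟨⟨⟨hA', ht'⟩, hb'⟩, hl'⟩, hr'⟩, h₀'⟩, hω⟩
    exact mem_embArmEvent_of_outward emb hiso hrh hω hm hNm hA' ht' hb' hl' hr' h₀'
  have hfin := emb.real_le_real_of_inter_subset hsub
  have hPA : 0 ≤ emb.isoradialPercolation.real A := measureReal_nonneg
  calc c ^ 5 * emb.embArmProb oneArmColour N (2 * m)
      = emb.isoradialPercolation.real A * c * c * c * c * c := by
        rw [hA, RhombicEmbedding.embArmProb]; ring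
    _ ≤ emb.isoradialPercolation.real (A ∩ Et) * c * c * c * c := by gcongr
    _ ≤ emb.isoradialPercolation.real (A ∩ Et ∩ Eb) * c * c * c := by gcongr
    _ ≤ emb.isoradialPercolation.real (A ∩ Et ∩ Eb ∩ El) * c * c := by gcongr
    _ ≤ emb.isoradialPercolation.real (A ∩ Et ∩ Eb ∩ El ∩ Er) * c := by gcongr
    _ ≤ emb.isoradialPercolation.real (A ∩ Et ∩ Eb ∩ El ∩ Er ∩ E₀) := h5
    _ ≤ emb.embArmProb oneArmColour N (4 * m) := hfin

/-! ### §5 The printed shape: radii halved / doubled at the cost of a constant -/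

/-- **GM Prop. (exp_equiv) (b), second inequality, `k = 1`, printed shape**: under the
box-crossing bounds at aspect ratio `4` with constant `c > 0` beyond scale `n₀`,
`P_G[A₁(2N, n)] ≤ c⁻⁵ · P_G[A₁(N, n)]` for `N ≥ n₀ ⊔ 2`, `n ≥ 4N`.
[cite: GrimmettManolescu2014Isoradial, §8.2 Prop. (exp_equiv) (b) (k = 1)] -/
theorem embArmProb_double_inner_le [Nonempty F] [Countable V] [DecidableEq V]
    (hiso : emb.IsIsoradial) (hrh : emb.IsRhombicTiling) {c : ℝ} (hc : 0 < c) {n₀ : ℕ}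
    (hbxp : BoxCrossingBounds emb.isoradialPercolation emb.z 4 c n₀) {N n : ℕ} (hn₀ : n₀ ≤ N)
    (hN : 2 ≤ N) (hn : 4 * N ≤ n) :
    emb.embArmProb oneArmColour (2 * N) n ≤ (c ^ 5)⁻¹ * emb.embArmProb oneArmColour N n := by
  have h := embArmProb_inward emb hiso hrh hbxp hn₀ hN hn
  have hc5 : 0 < c ^ 5 := by positivity
  rw [le_inv_mul_iff₀ hc5]
  exact h

/-- **GM Prop. (exp_equiv) (a), second inequality, `k = 1`, printed shape**: under the
box-crossing bounds at aspect ratio `4` with constant `c > 0` beyond scale `n₀`,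
`P_G[A₁(N, n)] ≤ c⁻¹⁰ · P_G[A₁(N, 2n)]` for `N ≥ n₀ ⊔ 2`, `n ≥ 2N` (two outward extensions at
the scales `⌊n/2⌋` and `2⌊n/2⌋`, and the elementary monotonicity in the outer radius).
[cite: GrimmettManolescu2014Isoradial, §8.2 Prop. (exp_equiv) (a) (k = 1)] -/
theorem embArmProb_le_double_outer [Nonempty F] [Countable V] [DecidableEq V]
    (hiso : emb.IsIsoradial) (hrh : emb.IsRhombicTiling) {c : ℝ} (hc : 0 < c) {n₀ : ℕ}
    (hbxp : BoxCrossingBounds emb.isoradialPercolation emb.z 4 c n₀) {N n : ℕ} (hn₀ : n₀ ≤ N)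
    (hN : 2 ≤ N) (hn : 2 * N ≤ n) :
    emb.embArmProb oneArmColour N n ≤ (c ^ 10)⁻¹ * emb.embArmProb oneArmColour N (2 * n) := by
  set m := n / 2 with hm
  have hmN : N ≤ m := by omega
  have hm₀ : n₀ ≤ m := hn₀.trans hmN
  have hm2 : 2 ≤ m := hN.trans hmN
  have hc5 : 0 < c ^ 5 := by positivity
  -- `P[A(N, n)] ≤ P[A(N, 2m)]`
  have h1 : emb.embArmProb oneArmColour N n ≤ emb.embArmProb oneArmColour N (2 * m) :=
    emb.embArmProb_outer_anti hiso oneArmColour (by omega) (by omega)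
  -- two outward extensions
  have h2 : c ^ 5 * emb.embArmProb oneArmColour N (2 * m) ≤ emb.embArmProb oneArmColour N (4 * m) :=
    embArmProb_outward emb hiso hrh hbxp hm₀ hm2 hmN
  have h3 : c ^ 5 * emb.embArmProb oneArmColour N (4 * m) ≤ emb.embArmProb oneArmColour N (8 * m) := by
    have h := embArmProb_outward emb hiso hrh hbxp (N := N) (m := 2 * m) (by omega) (by omega)
      (by omega)
    rwa [show 2 * (2 * m) = 4 * m by ring, show 4 * (2 * m) = 8 * m by ring] at h
  -- `P[A(N, 8m)] ≤ P[A(N, 2n)]`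
  have h4 : emb.embArmProb oneArmColour N (8 * m) ≤ emb.embArmProb oneArmColour N (2 * n) :=
    emb.embArmProb_outer_anti hiso oneArmColour (by omega) (by omega)
  have hP := emb.embArmProb_nonneg oneArmColour N (2 * m)
  rw [le_inv_mul_iff₀ (by positivity : 0 < c ^ 10)]
  calc c ^ 10 * emb.embArmProb oneArmColour N n
      ≤ c ^ 10 * emb.embArmProb oneArmColour N (2 * m) := by gcongr
    _ = c ^ 5 * (c ^ 5 * emb.embArmProb oneArmColour N (2 * m)) := by ring
    _ ≤ c ^ 5 * emb.embArmProb oneArmColour N (4 * m) := by gcongr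
    _ ≤ emb.embArmProb oneArmColour N (8 * m) := h3
    _ ≤ emb.embArmProb oneArmColour N (2 * n) := h4

/-- **Iterated inner doubling**: `P_G[A₁(2ᵏ N, n)] ≤ c⁻⁵ᵏ · P_G[A₁(N, n)]` for `N ≥ n₀ ⊔ 2` and
`2ᵏ⁺¹ N ≤ n` — the form "`P[A_k(c_d N, ·)] ≤ c P[A_k(N, ·)]`, by Prop. (exp_equiv) iterated" in
which the radii changes are absorbed in Grimmett–Manolescu 2014, §8.3 (proof of Lemma
(exp_transport1)). [cite: GrimmettManolescu2014Isoradial, §8.2 Prop. (exp_equiv) (b) iterated, §8.3] -/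
theorem embArmProb_pow_two_inner_le [Nonempty F] [Countable V] [DecidableEq V]
    (hiso : emb.IsIsoradial) (hrh : emb.IsRhombicTiling) {c : ℝ} (hc : 0 < c) {n₀ : ℕ}
    (hbxp : BoxCrossingBounds emb.isoradialPercolation emb.z 4 c n₀) {N n : ℕ} (hn₀ : n₀ ≤ N)
    (hN : 2 ≤ N) : ∀ k : ℕ, 2 ^ (k + 1) * N ≤ n →
      emb.embArmProb oneArmColour (2 ^ k * N) n ≤ ((c ^ 5)⁻¹) ^ k * emb.embArmProb oneArmColour N n
  | 0, _ => by simp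
  | k + 1, hk => by
    have hk' : 2 ^ (k + 1) * N ≤ n := le_trans (Nat.mul_le_mul_right N (Nat.pow_le_pow_right
      (by norm_num) (Nat.le_succ _))) hk
    have ih := embArmProb_pow_two_inner_le hiso hrh hc hbxp hn₀ hN k hk'
    have hNk : n₀ ≤ 2 ^ k * N := hn₀.trans (Nat.le_mul_of_pos_left N (pow_pos two_pos k))
    have hNk2 : 2 ≤ 2 ^ k * N := hN.trans (Nat.le_mul_of_pos_left N (pow_pos two_pos k))
    have hn4 : 4 * (2 ^ k * N) ≤ n := by
      calc 4 * (2 ^ k * N) = 2 ^ (k + 2) * N := by ring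
        _ ≤ n := hk
    have hstep := embArmProb_double_inner_le emb hiso hrh hc hbxp hNk hNk2 hn4
    have hc5 : 0 < (c ^ 5)⁻¹ := by positivity
    calc emb.embArmProb oneArmColour (2 ^ (k + 1) * N) n
        = emb.embArmProb oneArmColour (2 * (2 ^ k * N)) n := by ring_nf
      _ ≤ (c ^ 5)⁻¹ * emb.embArmProb oneArmColour (2 ^ k * N) n := hstep
      _ ≤ (c ^ 5)⁻¹ * (((c ^ 5)⁻¹) ^ k * emb.embArmProb oneArmColour N n) := by gcongr
      _ = ((c ^ 5)⁻¹) ^ (k + 1) * emb.embArmProb oneArmColour N n := by ring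

/-- **Iterated outer doubling**: `P_G[A₁(N, n)] ≤ c⁻¹⁰ᵏ · P_G[A₁(N, 2ᵏ n)]` for `N ≥ n₀ ⊔ 2` and
`2N ≤ n` (Prop. (exp_equiv) (a) iterated, as used in Grimmett–Manolescu 2014, §8.3).
[cite: GrimmettManolescu2014Isoradial, §8.2 Prop. (exp_equiv) (a) iterated, §8.3] -/
theorem embArmProb_le_pow_two_outer [Nonempty F] [Countable V] [DecidableEq V]
    (hiso : emb.IsIsoradial) (hrh : emb.IsRhombicTiling) {c : ℝ} (hc : 0 < c) {n₀ : ℕ}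
    (hbxp : BoxCrossingBounds emb.isoradialPercolation emb.z 4 c n₀) {N n : ℕ} (hn₀ : n₀ ≤ N)
    (hN : 2 ≤ N) (hn : 2 * N ≤ n) : ∀ k : ℕ,
      emb.embArmProb oneArmColour N n ≤ ((c ^ 10)⁻¹) ^ k * emb.embArmProb oneArmColour N (2 ^ k * n)
  | 0 => by simp
  | k + 1 => by
    have ih := embArmProb_le_pow_two_outer hiso hrh hc hbxp hn₀ hN hn k
    have hnk : 2 * N ≤ 2 ^ k * n := hn.trans (Nat.le_mul_of_pos_left n (pow_pos two_pos k))
    have hstep := embArmProb_le_double_outer emb hiso hrh hc hbxp hn₀ hN hnk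
    have hc10 : 0 ≤ ((c ^ 10)⁻¹) ^ k := by positivity
    calc emb.embArmProb oneArmColour N n
        ≤ ((c ^ 10)⁻¹) ^ k * emb.embArmProb oneArmColour N (2 ^ k * n) := ih
      _ ≤ ((c ^ 10)⁻¹) ^ k * ((c ^ 10)⁻¹ * emb.embArmProb oneArmColour N (2 * (2 ^ k * n))) := by
          gcongr
      _ = ((c ^ 10)⁻¹) ^ (k + 1) * emb.embArmProb oneArmColour N (2 ^ (k + 1) * n) := by ring_nf

/-! ### §6 On the class `𝒢(ε, I)`: consequences of the uniform box-crossing fact -/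

/-- Without faces there is no arm event (the event's dual data needs a face). [folklore] -/
theorem embArmEvent_oneArm_eq_empty [IsEmpty F] (r R : ℕ) :
    emb.embArmEvent oneArmColour r R = ∅ := by
  ext ω
  simp only [RhombicEmbedding.embArmEvent, Set.mem_setOf_eq, Set.mem_empty_iff_false, iff_false]
  rintro ⟨-, -, -, f, -⟩
  exact isEmptyElim (f 0)

/-- **GM Prop. (exp_equiv) (b) for one arm, uniformly on `𝒢(ε, I)`, from the uniform
box-crossing fact.** Assuming Grimmett–Manolescu's Theorem 3.1 in its uniform form
(`gm_boxCrossingBounds_uniform`: BXP with constants depending on `(ε, I, ρ)` only), for every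
`ε > 0` and `I` there are `C > 0` and `N₀` such that for every graph of the class `𝒢(ε, I)`
(preconnected, isoradial rhombic tiling, BAP(ε), SGP(I); vertex type in `Type`) and all
`N ≥ N₀`, `n ≥ 4N`: `P_G[A₁(2N, n)] ≤ C · P_G[A₁(N, n)]` — with `C = c(ε, I, 4)⁻⁵`.
[cite: GrimmettManolescu2014Isoradial, §8.2 Prop. (exp_equiv) (b) (k = 1), via §3 Thm 3.1 / (3.1)] -/
theorem oneArm_double_inner_of_gm_boxCrossingBounds_uniform (h : gm_boxCrossingBounds_uniform)
    (ε : ℝ) (hε : 0 < ε) (I : ℕ) :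
    ∃ C > (0 : ℝ), ∃ N₀ : ℕ, ∀ (V F : Type) [Countable V] [DecidableEq V] [DecidableEq F]
      (G : SimpleGraph V) [G.LocallyFinite] (emb : RhombicEmbedding G F),
      G.Preconnected → emb.IsIsoradial → emb.IsRhombicTiling → emb.HasBoundedAngles ε →
      emb.SquareGridPropertyGM I → ∀ N n : ℕ, N₀ ≤ N → 4 * N ≤ n →
        emb.embArmProb oneArmColour (2 * N) n ≤ C * emb.embArmProb oneArmColour N n := by
  obtain ⟨c, hc, n₀, hbxp⟩ := h ε hε I 4 (by norm_num)
  refine ⟨(c ^ 5)⁻¹, by positivity, max n₀ 2, ?_⟩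
  intro V F _ _ _ G _ emb hconn hiso hrh hbap hsgp N n hN hn
  rcases isEmpty_or_nonempty F with hF | hF
  · simp [RhombicEmbedding.embArmProb, embArmEvent_oneArm_eq_empty]
  · exact embArmProb_double_inner_le emb hiso hrh hc (hbxp V F G emb hconn hiso hrh hbap hsgp)
      ((le_max_left _ _).trans hN) ((le_max_right _ _).trans hN) hn

/-- **GM Prop. (exp_equiv) (a) for one arm, uniformly on `𝒢(ε, I)`, from the uniform
box-crossing fact**: for every `ε > 0` and `I` there are `C > 0` and `N₀` such that for every
graph of `𝒢(ε, I)` and all `N ≥ N₀`, `n ≥ 2N`: `P_G[A₁(N, n)] ≤ C · P_G[A₁(N, 2n)]` — with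
`C = c(ε, I, 4)⁻¹⁰`.
[cite: GrimmettManolescu2014Isoradial, §8.2 Prop. (exp_equiv) (a) (k = 1), via §3 Thm 3.1 / (3.1)] -/
theorem oneArm_double_outer_of_gm_boxCrossingBounds_uniform (h : gm_boxCrossingBounds_uniform)
    (ε : ℝ) (hε : 0 < ε) (I : ℕ) :
    ∃ C > (0 : ℝ), ∃ N₀ : ℕ, ∀ (V F : Type) [Countable V] [DecidableEq V] [DecidableEq F]
      (G : SimpleGraph V) [G.LocallyFinite] (emb : RhombicEmbedding G F),
      G.Preconnected → emb.IsIsoradial → emb.IsRhombicTiling → emb.HasBoundedAngles ε →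
      emb.SquareGridPropertyGM I → ∀ N n : ℕ, N₀ ≤ N → 2 * N ≤ n →
        emb.embArmProb oneArmColour N n ≤ C * emb.embArmProb oneArmColour N (2 * n) := by
  obtain ⟨c, hc, n₀, hbxp⟩ := h ε hε I 4 (by norm_num)
  refine ⟨(c ^ 10)⁻¹, by positivity, max n₀ 2, ?_⟩
  intro V F _ _ _ G _ emb hconn hiso hrh hbap hsgp N n hN hn
  rcases isEmpty_or_nonempty F with hF | hF
  · simp [RhombicEmbedding.embArmProb, embArmEvent_oneArm_eq_empty]
  · exact embArmProb_le_double_outer emb hiso hrh hc (hbxp V F G emb hconn hiso hrh hbap hsgp)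
      ((le_max_left _ _).trans hN) ((le_max_right _ _).trans hN) hn

end IsoradialArmExtension

end Literature.Probability.Percolation

end
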